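import Literature.Analysis.FluidPDE.SereginSverak2002HeadReduction
import HarnessLib

/-!
# Seregin–Šverák 2002, the head-ceiling statement (`|u|² + 2p ≤ M` ⇒ regular) as a named fact,
# and the one-sided-bound fact assembled from it

Analysis/FluidPDE facts file. Fact-decomposition record (librarian, `fact-decompose`, 2026-08-16)
for the named fact `SereginSverak2002_pressureOneSidedBound` (`SereginSverak2002PressureLowerBound.lean`;
G. Seregin, V. Šverák, *Navier–Stokes equations with lower bounds on the pressure*, Arch. Ration.
Mech. Anal. 163 (2002) 65–86, main theorem, bounded majorant `g ≡ M`: a classical Leray–Hopf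
solution on `[0, T)` with rapidly decaying datum and EITHER (b) `p̃ ≥ -M` OR (a) `|u|² + 2p̃ ≤ M`
on `(0, T) × ℝ³` has no singular point in `(0, T] × ℝ³`).

State of the printed theorem in the tree. The paper proves two statements by one method — the
pressure-floor theorem (b) and (p. 66) "our method also gives a proof of the following statement …
If the quantity `|u|² + 2p` is bounded from above, the solution must be regular" — and the tree's
fact is their conjunction. Alternative (b) is now a THEOREM of the tree
(`SereginSverak2002.isBackwardBoundedAt_of_floor`, `SereginSverak2002CaseB.lean`: blow-up at a top
point, finite log-tangential energy, the zero extension is suitable across `t = 0`, and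
Caffarelli–Kohn–Nirenberg forbids the concentration), the viscosity is normalised by scaling
(`…of_unitViscosity`) and interior times are regular by continuity, so that
`SereginSverak2002_pressureOneSidedBound.iff_headCase` (`SereginSverak2002HeadReduction.lean`)
PROVES: **the fact is equivalent to the head-ceiling statement (a) at unit viscosity and top
points `(T, x₀)`.**

This file NAMES that residual statement — the paper's second theorem, p. 66, in the bounded case
and the tree's classical class — as the fact `SereginSverak2002_headCeiling_regular` (the right-hand
side of `iff_headCase` verbatim) and records the assembly
`SereginSverak2002_pressureOneSidedBound_holds_of` (one line, `of_headCase`). The equivalence with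
the parent is a theorem of the tree only because case (b) has been proved there; as printed, (a)
and (b) are distinct statements with parallel proofs, and (a) is what a discharge still has to
supply (equivalently, by `of_headCase_cknAEss_small`, the decay `A(r; (T, x₀)) → 0` of the scaled
energy at top points under the head ceiling, the paper's Lemma 3.3 being proved:
`isBackwardBoundedAt_of_cknAEss_le`). Source status: the ARMA paper is cite-only on this hub
(acq-01580); the statement of (a) is read in the abstract and on p. 66 as quoted in
`SereginSverak2002HeadReduction.lean`, and in the secondary statements listed in the parent's
module docstring (Moffatt–Kimura 2018 §1; Miller 2021 §1: "`p + ½|u|²` must become unbounded above").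

## References

* [SereginSverak2002] G. Seregin, V. Šverák, Arch. Ration. Mech. Anal. 163 (2002) 65–86:
  abstract, §1 p. 66 (the statement for `|u|² + 2p`), Thm. 2.2, Lemma 3.3.
* [Miller2021Growth] §1; [MoffattKimura2018] §1 (secondary statements).
-/

noncomputable section

open _root_.MeasureTheory Set Function Metric

namespace Literature.Analysis.FluidPDE

/-- NAMED FACT — **Seregin–Šverák 2002, head-ceiling theorem, bounded majorant, unit viscosity,
top points** (p. 66: "If the quantity `|u|² + 2p` is bounded from above, the solution must be
regular"). Let `T > 0` and let `(u, p)` be a classical solution of the unforced Navier–Stokes system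
with viscosity `1` on `[0, T) × ℝ³` which is a weak Leray–Hopf solution of the Cauchy problem on
`[0, T)` with smooth rapidly decaying datum `u 0`. If for some constant `M` the doubled Bernoulli
head of the normalised pressure is bounded above, `|u(t, x)|² + 2 p̃(t, x) ≤ M` for all
`t ∈ (0, T)`, `x ∈ ℝ³` (`p̃ = RᵢRⱼ(uᵢuⱼ) = normalisedPressure (u t)`), then `u` is bounded on some
backward cylinder `(T - r², T) × B(x₀, r)` at every `x₀` (`IsBackwardBoundedAt u T x₀`: no blow-up
at the final time). This is the right-hand side of
`SereginSverak2002_pressureOneSidedBound.iff_headCase` verbatim — the part of the one-sided-bound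
fact that remains after the pressure-floor alternative was proved in the tree
(`SereginSverak2002.isBackwardBoundedAt_of_floor`). Nothing asserted; users take
`(h : SereginSverak2002_headCeiling_regular)`.
[cite: SereginSverak2002, §1 p. 66 (statement for |u|²+2p) and Thm. 2.2, bounded case g ≡ M] -/
def SereginSverak2002_headCeiling_regular : Prop :=
  ∀ (T : ℝ) (u : ℝ → EuclideanSpace ℝ (Fin 3) → EuclideanSpace ℝ (Fin 3))
    (p : ℝ → EuclideanSpace ℝ (Fin 3) → ℝ), 0 < T →
    IsClassicalNSSolutionOn (Ico 0 T) 1 0 u p → IsLerayHopfOn T 1 0 (u 0) u →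
    HasRapidSpatialDecay (u 0) →
    ∀ M : ℝ, (∀ t ∈ Ioo 0 T, ∀ x, ‖u t x‖ ^ 2 + 2 * normalisedPressure (u t) x ≤ M) →
    ∀ x₀ : EuclideanSpace ℝ (Fin 3), IsBackwardBoundedAt u T x₀

/-- **Assembly (fact-decompose): the one-sided-bound fact from the head-ceiling fact.**
`SereginSverak2002_pressureOneSidedBound` follows from `SereginSverak2002_headCeiling_regular` by
`SereginSverak2002_pressureOneSidedBound.of_headCase` (viscosity scaling, the PROVED pressure-floor
case, and continuity at interior times). [cite: SereginSverak2002, §1 p. 66 and Thm. 2.2] -/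
theorem SereginSverak2002_pressureOneSidedBound_holds_of (h : SereginSverak2002_headCeiling_regular) :
    SereginSverak2002_pressureOneSidedBound :=
  SereginSverak2002_pressureOneSidedBound.of_headCase h

/-- Conversely the head-ceiling fact is a consequence of the one-sided-bound fact (so the two are
equivalent in the tree; recorded to make the decomposition's bookkeeping checkable).
[cite: SereginSverak2002, §1 p. 66 and Thm. 2.2] -/
theorem SereginSverak2002_headCeiling_regular_of_pressureOneSidedBound
    (h : SereginSverak2002_pressureOneSidedBound) : SereginSverak2002_headCeiling_regular :=
  SereginSverak2002_pressureOneSidedBound.iff_headCase.mp h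

end Literature.Analysis.FluidPDE

end
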